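import Literature.MathematicalPhysics.QuantumFieldTheory.Balaban1983to89.B11Eq56CubicRemainderUniform

/-!
# `Balaban1983to89.B11Ineq73KernelLettersUniform` — T. Bałaban, *The variational problem and background fields in renormalization group method
# for lattice gauge theories*, Commun. Math. Phys. **102** (1985) 277–309 [Balaban1985Variational]: (73) p. 289 (+ «𝔇₂ … (73) with ε₃² instead of
# ε₃»), Prop. 4 (97)–(98) pp. 292–293 — THE KERNEL-COLUMN LETTERS `θ_E`, `θ₃` AND THE (98)-CONSTANT `C₄` OF `W = (δ/δA′)V` IN CLOSED FORM IN THE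
# BOUNDS: NE9 leaf-01's `B11Ineq73KernelLettersPerLattice.exists_quadAnalytic_W80` WITH ITS `∃ R′ C₄` MOVED BEFORE THE DATA (the covariant
# derivative `∇` of the carrier (115), the letters `H`, `C` of the Sect. C regime, `ρ`, `tr`, the background `U₀`, the currents `J`, `Δ_π`) —
# uniform over every family obeying ONE set of bounds `(b, C₂, c₄, a_C, ε_C, C_V, R_V, M_ρ, M_τ, M_J, M_Δ, M_D)` at a fixed lattice

statement-level skeleton of published theorems with citation tags; proofs where landed; nothing here is a claim about the Yang–Mills mass gap

THE PRINT (verbatim).  p. 289: *«|𝔇(A′; c, b)| ≦ O(1)C₃ε₃(Lʲη)^{−d+1}e^{−(1/2)δ₀d(c₋,y)}, b ∈ Bʲ(y), y ∈ Λ_j. (73)»*; p. 293 after (98): *«C₄ depend[s] on d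
and L only»*.  WHAT IS PROVED is NOT (73) and NOT that uniformity: it is uniformity IN THE DATA at a FIXED lattice — the two kernel letters and the
(98)-constant are functions of the displayed BOUNDS, the column constant `κ` of NE9 leaf-01's §2 being bounded through a bound `M_D` on the carrier's
`∇` (`κ̄(M_D)`, a double bond sum — NO decay).

WHY THIS FILE (cell context, pub-balaban NE9).  In the one-instance chart of `cur U` (ne9-leaf-05's (B) `Support/NE9CurChartOneInstance`, T23; (A′)
`Support/NE9CurChartOneInstanceSmallField`, T24) the W-slot's (98)-constant is produced per background `U` by leaf-01's `exists_quadAnalytic_W80`: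
its `θ_E` carries `κ(∇_U)`, its `θ₃` the `isBigO` Taylor remainder of `C(U)`.  The uniform-ball species `Support/NE9CurChartOneInstanceUniformBall`
(ne9-leaf-05 gen 68) therefore DISPLAYS `C₄`; THIS FILE discharges that display at a fixed lattice: with the owner's (K) `B9Eq3126H1BoundCLM` (`b = C_H′`
uniform over the small-field set), (N) `B11Eq117TransformationNorm.norm_nabla115_le` (`M_D = 2|η|⁻¹`), NE9 leaf-03's U-free `C(U)` constants and NE9
leaf-01's closed-form T-slot radii, every input of `exists_quadAnalytic_W80_uniform` below is a U-free number.

WHAT IS PROVED (sorry-free; no definition; no `Prop` placeholder; nothing of [B11]'s inequalities asserted).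
* §1 **`colSum_kernel_fderiv_E3_le_of_cubic`** — leaf-01's `exists_theta3` with the cubic bound `‖HD₃(Y)‖ ≤ γ‖Y‖³` on `‖Y‖ < R₃ ≤ a_C` a LETTER:
  `Σ_{b′}(w₃(b)/w₃(b′))‖k_{(HD₃)′(A′)}(b′, b)‖ ≤ κ(∇)·(γR₃³∕(R′²(R₃ − R′)))·‖A′‖²` on `‖A′‖ < R′ < R₃` (Cauchy, power form `n = 2`).
* §2 **`norm_evalCLM_le`** (`‖eval_{b′}‖ ≤ w₁(b′)⁻¹`, ∇-free), **`norm_single115_le`** (`‖δ_b‖ ≤ max (w₁(b)) (W₂⁺·M_D)` from `‖∇g‖_∞ ≤ M_D‖g‖_∞`),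
  **`colConst_le`** (`κ(∇) ≤ κ̄(M_D) := Σ_b Σ_{b′} (w₃(b)/w₃(b′))·w₁(b′)⁻¹·max (w₁(b)) (W₂⁺M_D)`).
* §3 `C4W_mono` (the (97)-constant is monotone in `‖ρ‖, ‖tr‖, ‖J‖, ‖Δ_π‖, θ₃, θ_E`), `quadAnalytic_mono_const`.
* §4 **`exists_quadAnalytic_W80_uniform`** — for numbers `b, C₂ ≥ 0`, `0 ≤ ε_C`, `0 < a_C`, `2(ε_C + a_C) ≤ c₄`, `4bC₂(ε_C + a_C) < 1`, `C_V ≥ 0`,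
  `R_V > 0`, `M_ρ M_τ M_J M_Δ M_D ≥ 0`: `∃ R′ ∈ (0, a_C], ∃ C₄ ≥ 0` such that FOR EVERY `∇` with `‖∇g‖ ≤ M_D‖g‖`, EVERY `H`, `C` with
  `Regime H 0 C b 0 C₂ c₄ 0 a_C ε_C`, `Prop4Hyp C C₂ c₄`, EVERY `ρ`, `tr`, `U₀` with `‖ρ‖ ≤ M_ρ`, `‖tr‖ ≤ M_τ` and the V₀-group's slot at `(C_V, R_V)`,
  EVERY `J`, `Δ_π` with `‖J‖ ≤ M_J`, `‖Δ_π‖ ≤ M_Δ`: `QuadAnalytic (W80 ρ tr U₀ H C ε_C J Δ_π) C₄ R′ ∧ AnalyticOnNhd ℂ (W80 …) {‖Y‖ < R′}` — (E)'s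
  `quadAnalytic_W80` fed with `θ_E := κ̄·bC₂ℓ²a_C²∕(R′(a_C − R′))`, `θ₃ := κ̄·γR₃³∕(R′²(R₃ − R′))` at `B11Eq56CubicRemainderUniform`'s closed-form
  `(R₃, γ)`, `R′ := min (R₃∕2) ((1 − 4bC₂(ε_C + a_C))R_V)`, and `C₄ := C4W M_ρ M_τ M_J M_Δ b C₂ ℓ θ₃ θ_E C_V R′` (monotonicity §3).
HONEST SCOPE.  (i) Uniform in the DATA at a fixed lattice; `κ̄`, hence `C₄`, counts bonds and inverse weights — NOT «d and L only», NOT (73).  (ii) Nothing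
instantiated at the chain's letters here (the consumer's one-liner, `Support/NE9CurChartOneInstanceUniformBall` v1.1).  (iii) NOT summit progress (cell
pub-balaban: NE9 NOT PRINTED ∕ NOT PROVED; «NE9 ⇐ the named binders»; spine PROVED 0∕9; HONEST DEPENDENCY: continuum YM on T⁴ ⇐ BetaPertH ∧ nine spine
estimates (0/9 proved); BetaPertH ⇐ (D1) ∧ (D4) ∧ CAP+tail; G-an2-4 gates asym, D1 and NE2/3/4).  Filed by the NE9 crux-team leaf seat
`b2b-balaban-t4-ne9-formalise-leaf-05` (gen 68); NEW file; imports `B11Eq56CubicRemainderUniform` ONLY; nothing modified.  Net new unproved facts: 0.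
-/

noncomputable section

open scoped BigOperators
namespace Literature.MathematicalPhysics.QuantumFieldTheory.Balaban1983to89.B11Ineq73KernelLettersUniform

open Metric Set Filter Topology
open Literature.MathematicalPhysics.QuantumFieldTheory.Balaban1983to89.B13Contraction113 (QuadAnalytic)
open Literature.MathematicalPhysics.QuantumFieldTheory.Balaban1983to89.B11Prop6Scheme (Prop4Hyp)
open Literature.MathematicalPhysics.QuantumFieldTheory.Balaban1983to89.B11Eq174Chart (Regime)
open Literature.MathematicalPhysics.QuantumFieldTheory.Balaban1983to89.B11Eq90Transpose (kernel single115)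
open Literature.MathematicalPhysics.QuantumFieldTheory.Balaban1983to89.B11Eq80Current (Emap E3 W80 analyticOnNhd_E3)
open Literature.MathematicalPhysics.QuantumFieldTheory.Balaban1983to89.B11Eq63V0GroupCurrent (curV0)
open Literature.MathematicalPhysics.QuantumFieldTheory.Balaban1983to89.B11Eq98CurrentSlot (C4W C4W_nonneg quadAnalytic_W80)
open Literature.MathematicalPhysics.QuantumFieldTheory.Balaban1983to89.B12SecondOrder267 (fderiv_zero_of_norm_le_sq)
open Literature.MathematicalPhysics.QuantumFieldTheory.Balaban1983to89.B11Ineq73KernelLettersPerLattice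
  (norm_fderiv_le_of_pow_bound colSum_kernel_le colSum_kernel_fderiv_Emap_le)
open Literature.MathematicalPhysics.QuantumFieldTheory.Balaban1983to89.B11Eq56CubicRemainderUniform (norm_E3_le_cubic)
open B9SectCLatticeCarrier (Bond)
open B11Eq115Space

variable {𝔸 : Type*} [NormedRing 𝔸] [NormedAlgebra ℂ 𝔸] [FiniteDimensional ℂ 𝔸]
variable {d : ℕ} {Pd : Fin d → ℕ} {L η : ℝ} [Fact (0 < L)] [Fact (0 < η)] {lev₀ : Bond d Pd → ℕ} {κ' : Type*} [Fintype κ']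
  {lev₁ : κ' → ℕ}
variable {𝒳 : Type*} [NormedAddCommGroup 𝒳] [NormedSpace ℂ 𝒳]

/-! ## §1 `θ₃` from a cubic LETTER: leaf-01's §4 with `(R₃, γ)` displayed -/

section Theta3

variable {Dc : (Bond d Pd → 𝔸) →ₗ[ℂ] (κ' → 𝔸)}
variable {H : 𝒳 →L[ℂ] Space115 L η lev₀ lev₁ Dc} {C : Space115 L η lev₀ lev₁ Dc → 𝒳} {b C₂ c₄ aC εC : ℝ}

/-- **THE `θ₃`-BINDER FROM A CUBIC VALUE BOUND WITH DISPLAYED `(R₃, γ)`**: if `‖HD₃(Y)‖ ≤ γ‖Y‖³` on `‖Y‖ < R₃ ≤ a_C` (a LETTER — e.g.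
`B11Eq56CubicRemainderUniform.norm_E3_le_cubic`'s closed form), then on every ball `‖A′‖ < R′ < R₃` the weighted kernel columns of `(HD₃)′(A′)` are
`≤ κ(∇)·(γR₃³∕(R′²(R₃ − R′)))·‖A′‖²`, `κ(∇)` the column constant of leaf-01's `colSum_kernel_le` (Cauchy on the ball of radius `‖A′‖R₃∕R′`; at
`A′ = 0` the derivative vanishes).  Print p. 289 «(73) with ε₃² instead of ε₃», per lattice. [cite: Balaban1985Variational, (73) p.289, (86) p.291] -/
theorem colSum_kernel_fderiv_E3_le_of_cubic [CompleteSpace 𝒳] [CompleteSpace 𝔸] (RC : Regime H 0 C b 0 C₂ c₄ 0 aC εC)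
    (hC : Prop4Hyp C C₂ c₄) {R₃ γ : ℝ} (hR₃a : R₃ ≤ aC) (hγ : 0 ≤ γ)
    (hcub : ∀ Y : Space115 L η lev₀ lev₁ Dc, ‖Y‖ < R₃ → ‖E3 H C εC Y‖ ≤ γ * ‖Y‖ ^ 3)
    {R' : ℝ} (hR'0 : 0 < R') (hR'R : R' < R₃) {A' : Space115 L η lev₀ lev₁ Dc} (hA' : ‖A'‖ < R') (bb : Bond d Pd) :
    ∑ b' : Bond d Pd, levWeight L η lev₀ 3 bb / levWeight L η lev₀ 3 b' * ‖kernel (fderiv ℂ (E3 H C εC) A') b' bb‖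
      ≤ (∑ bb : Bond d Pd, ∑ b' : Bond d Pd, levWeight L η lev₀ 3 bb / levWeight L η lev₀ 3 b'
            * ‖JetSup.evalCLM (𝕜 := ℂ) (levWeight L η lev₀ 1) (levWeight L η lev₁ 2) Dc b'‖
            * ‖single115 (L := L) (η := η) (lev₀ := lev₀) (lev₁ := lev₁) (Dc := Dc) bb‖)
          * (γ * R₃ ^ 3 / (R' ^ 2 * (R₃ - R'))) * ‖A'‖ ^ 2 := by
  have hR₃ : 0 < R₃ := hR'0.trans hR'R
  have hw : ∀ b : Bond d Pd, 0 < levWeight L η lev₀ 3 b := levWeight_pos (Fact.out : 0 < L) (Fact.out : 0 < η) lev₀ 3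
  have hκ0 : 0 ≤ ∑ bb : Bond d Pd, ∑ b' : Bond d Pd, levWeight L η lev₀ 3 bb / levWeight L η lev₀ 3 b'
      * ‖JetSup.evalCLM (𝕜 := ℂ) (levWeight L η lev₀ 1) (levWeight L η lev₁ 2) Dc b'‖
      * ‖single115 (L := L) (η := η) (lev₀ := lev₀) (lev₁ := lev₁) (Dc := Dc) bb‖ :=
    Finset.sum_nonneg fun bb _ => Finset.sum_nonneg fun b' _ => by
      have := (hw bb).le; have := (hw b').le; positivity
  have hd : DifferentiableOn ℂ (E3 H C εC) (ball (0 : Space115 L η lev₀ lev₁ Dc) R₃) :=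
    (analyticOnNhd_E3 RC hC).differentiableOn.mono (ball_subset_ball hR₃a)
  have hR3R : 0 < R₃ - R' := sub_pos.2 hR'R
  have hop : ‖fderiv ℂ (E3 H C εC) A'‖ ≤ γ * R₃ ^ 3 / (R' ^ 2 * (R₃ - R')) * ‖A'‖ ^ 2 := by
    rcases eq_or_ne A' 0 with rfl | hA0
    · have hq : ∀ z : Space115 L η lev₀ lev₁ Dc, ‖z‖ < R₃ → ‖E3 H C εC z‖ ≤ γ * R₃ * ‖z‖ ^ 2 := fun z hz =>
        (hcub z hz).trans (by
          calc γ * ‖z‖ ^ 3 = γ * ‖z‖ * ‖z‖ ^ 2 := by ring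
            _ ≤ γ * R₃ * ‖z‖ ^ 2 := by gcongr)
      rw [fderiv_zero_of_norm_le_sq (𝕜 := ℂ) hR₃ hq, norm_zero, norm_zero]; positivity
    · exact norm_fderiv_le_of_pow_bound (n := 2) hd hγ hcub hR'0 hR'R hA0 hA'
  calc _ ≤ _ * ‖fderiv ℂ (E3 H C εC) A'‖ := colSum_kernel_le _ bb
    _ ≤ _ * (γ * R₃ ^ 3 / (R' ^ 2 * (R₃ - R')) * ‖A'‖ ^ 2) := mul_le_mul_of_nonneg_left hop hκ0
    _ = _ := by ring

end Theta3

/-! ## §2 The column constant `κ(∇)` is bounded through a bound on `∇` -/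

section ColConst

variable {Dc : (Bond d Pd → 𝔸) →ₗ[ℂ] (κ' → 𝔸)}

omit [FiniteDimensional ℂ 𝔸] in
/-- **`‖eval_{b′}‖ ≤ w₁(b′)⁻¹`** on the space (115) (`w₁ = (Lʲη)¹` the weight of `|·|_{(−1)}`): evaluation reads the zeroth-order part, whose
weighted sup is at most the (115)-norm — INDEPENDENT of `∇`. [cite: Balaban1985Variational, (115) p.294] -/
theorem norm_evalCLM_le (b' : Bond d Pd) :
    ‖JetSup.evalCLM (𝕜 := ℂ) (levWeight L η lev₀ 1) (levWeight L η lev₁ 2) Dc b'‖ ≤ (levWeight L η lev₀ 1 b')⁻¹ := by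
  have hw : 0 < levWeight L η lev₀ 1 b' := levWeight_pos (Fact.out : 0 < L) (Fact.out : 0 < η) lev₀ 1 b'
  refine ContinuousLinearMap.opNorm_le_bound _ (by positivity) fun f => ?_
  have h := JetSup.weight_mul_norm_apply_le f b'
  have heq : ‖JetSup.evalCLM (𝕜 := ℂ) (levWeight L η lev₀ 1) (levWeight L η lev₁ 2) Dc b' f‖
      = ‖JetSup.equiv (levWeight L η lev₀ 1) (levWeight L η lev₁ 2) Dc f b'‖ := rfl
  rw [heq, inv_mul_eq_div, le_div_iff₀ hw, mul_comm]
  exact h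

/-- **`‖δ_b‖ ≤ max (w₁(b)) (W₂⁺·M_D)`** for the one-bond injection into the space (115), given `‖∇g‖_∞ ≤ M_D‖g‖_∞` (`W₂⁺ = max_p w₂(p)` the largest
weight of `|·|_{(−2)}`): the zeroth-order part of `δ_b X` has weighted sup `w₁(b)‖X‖`, its `∇`-part has weighted sup `≤ W₂⁺M_D‖X‖`.
[cite: Balaban1985Variational, (90) p.291, (115) p.294] -/
theorem norm_single115_le {MD : ℝ} (hMD : 0 ≤ MD) (hD : ∀ g : Bond d Pd → 𝔸, ‖Dc g‖ ≤ MD * ‖g‖) (bb : Bond d Pd) :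
    ‖single115 (L := L) (η := η) (lev₀ := lev₀) (lev₁ := lev₁) (Dc := Dc) bb‖
      ≤ max (levWeight L η lev₀ 1 bb) ((NegSup.wSup (levWeight L η lev₁ 2) : ℝ) * MD) := by
  classical
  have hw1 : ∀ b : Bond d Pd, 0 < levWeight L η lev₀ 1 b := levWeight_pos (Fact.out : 0 < L) (Fact.out : 0 < η) lev₀ 1
  have hK : 0 ≤ max (levWeight L η lev₀ 1 bb) ((NegSup.wSup (levWeight L η lev₁ 2) : ℝ) * MD) :=
    le_max_of_le_left (hw1 bb).le
  refine ContinuousLinearMap.opNorm_le_bound _ hK fun X => ?_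
  have hflat : JetSup.equiv (levWeight L η lev₀ 1) (levWeight L η lev₁ 2) Dc
      (single115 (L := L) (η := η) (lev₀ := lev₀) (lev₁ := lev₁) (Dc := Dc) bb X) = Pi.single bb X :=
    B11Eq90Transpose.flat115_single115 (L := L) (η := η) (lev₀ := lev₀) (lev₁ := lev₁) (Dc := Dc) bb X
  rw [JetSup.norm_le_iff_pointwise (by positivity), hflat]
  refine ⟨fun i => ?_, fun k => ?_⟩
  · by_cases hi : i = bb
    · subst hi
      rw [Pi.single_eq_same]
      exact mul_le_mul_of_nonneg_right (le_max_left _ _) (norm_nonneg X)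
    · rw [Pi.single_eq_of_ne hi, norm_zero, mul_zero]; positivity
  · have h1 : ‖Dc (Pi.single bb X) k‖ ≤ ‖Dc (Pi.single bb X)‖ := norm_le_pi_norm _ k
    have h2 : ‖Dc (Pi.single bb X)‖ ≤ MD * ‖X‖ := (hD _).trans (by rw [Pi.norm_single])
    have h3 : levWeight L η lev₁ 2 k ≤ (NegSup.wSup (levWeight L η lev₁ 2) : ℝ) := NegSup.le_wSup k
    have h4 : 0 ≤ levWeight L η lev₁ 2 k := (levWeight_pos (Fact.out : 0 < L) (Fact.out : 0 < η) lev₁ 2 k).le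
    calc levWeight L η lev₁ 2 k * ‖Dc (Pi.single bb X) k‖
        ≤ (NegSup.wSup (levWeight L η lev₁ 2) : ℝ) * (MD * ‖X‖) := mul_le_mul h3 (h1.trans h2) (norm_nonneg _) (NegSup.wSup _).coe_nonneg
      _ = ((NegSup.wSup (levWeight L η lev₁ 2) : ℝ) * MD) * ‖X‖ := by ring
      _ ≤ max (levWeight L η lev₀ 1 bb) ((NegSup.wSup (levWeight L η lev₁ 2) : ℝ) * MD) * ‖X‖ :=
          mul_le_mul_of_nonneg_right (le_max_right _ _) (norm_nonneg X)

/-- **THE COLUMN CONSTANT THROUGH A BOUND ON `∇`**: `κ(∇) ≤ κ̄(M_D) := Σ_b Σ_{b′} (w₃(b)/w₃(b′))·w₁(b′)⁻¹·max (w₁(b)) (W₂⁺M_D)` — so leaf-01's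
PER-LATTICE letters `θ_E = κ·(…)`, `θ₃ = κ·(…)` are bounded UNIFORMLY over every family of carriers (115) whose `∇` obeys `‖∇g‖_∞ ≤ M_D‖g‖_∞` (the
NE9 chain: `∇ = nabla115 η U`, `M_D = 2|η|⁻¹` for unit-bounded `U`, (N) `norm_nabla115_le`). A double bond sum: NO decay, per lattice.
[cite: Balaban1985Variational, (73) p.289, (86) p.291, (115) p.294] -/
theorem colConst_le {MD : ℝ} (hMD : 0 ≤ MD) (hD : ∀ g : Bond d Pd → 𝔸, ‖Dc g‖ ≤ MD * ‖g‖) :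
    (∑ bb : Bond d Pd, ∑ b' : Bond d Pd, levWeight L η lev₀ 3 bb / levWeight L η lev₀ 3 b'
        * ‖JetSup.evalCLM (𝕜 := ℂ) (levWeight L η lev₀ 1) (levWeight L η lev₁ 2) Dc b'‖
        * ‖single115 (L := L) (η := η) (lev₀ := lev₀) (lev₁ := lev₁) (Dc := Dc) bb‖)
      ≤ ∑ bb : Bond d Pd, ∑ b' : Bond d Pd, levWeight L η lev₀ 3 bb / levWeight L η lev₀ 3 b'
        * (levWeight L η lev₀ 1 b')⁻¹ * max (levWeight L η lev₀ 1 bb) ((NegSup.wSup (levWeight L η lev₁ 2) : ℝ) * MD) := by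
  have hw : ∀ b : Bond d Pd, 0 < levWeight L η lev₀ 3 b := levWeight_pos (Fact.out : 0 < L) (Fact.out : 0 < η) lev₀ 3
  have hw1 : ∀ b : Bond d Pd, 0 < levWeight L η lev₀ 1 b := levWeight_pos (Fact.out : 0 < L) (Fact.out : 0 < η) lev₀ 1
  refine Finset.sum_le_sum fun bb _ => Finset.sum_le_sum fun b' _ => ?_
  have hq : 0 ≤ levWeight L η lev₀ 3 bb / levWeight L η lev₀ 3 b' := div_nonneg (hw bb).le (hw b').le
  exact mul_le_mul (mul_le_mul_of_nonneg_left (norm_evalCLM_le b') hq) (norm_single115_le hMD hD bb) (norm_nonneg _)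
    (mul_nonneg hq (inv_nonneg.2 (hw1 b').le))

end ColConst

/-! ## §3 Monotonicity of the (97)-constant and of the (98)-slot in their letters -/

/-- `C4W` is monotone in the letters `‖ρ‖, ‖tr‖, ‖J‖, ‖Δ_π‖, θ₃, θ_E` (all its coefficients are non-negative). [cite: Balaban1985Variational, (97) p.293] -/
theorem C4W_mono {nρ nτ nJ nΔ nρ' nτ' nJ' nΔ' b C₂ ℓ θ₃ θE θ₃' θE' CV R' : ℝ} (hρ0 : 0 ≤ nρ) (hτ0 : 0 ≤ nτ) (hJ0 : 0 ≤ nJ)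
    (hΔ0 : 0 ≤ nΔ) (hb : 0 ≤ b) (hC₂ : 0 ≤ C₂) (h30 : 0 ≤ θ₃) (hE0 : 0 ≤ θE) (hCV : 0 ≤ CV) (hR' : 0 ≤ R')
    (hρ : nρ ≤ nρ') (hτ : nτ ≤ nτ') (hJ : nJ ≤ nJ') (hΔ : nΔ ≤ nΔ') (h3 : θ₃ ≤ θ₃') (hE : θE ≤ θE') :
    C4W nρ nτ nJ nΔ b C₂ ℓ θ₃ θE CV R' ≤ C4W nρ' nτ' nJ' nΔ' b C₂ ℓ θ₃' θE' CV R' := by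
  unfold C4W
  have hbC : 0 ≤ b * C₂ * ℓ ^ 2 := by positivity
  have hρ'0 : 0 ≤ nρ' := hρ0.trans hρ
  have hτ'0 : 0 ≤ nτ' := hτ0.trans hτ
  have hJ'0 : 0 ≤ nJ' := hJ0.trans hJ
  have hΔ'0 : 0 ≤ nΔ' := hΔ0.trans hΔ
  have h3'0 : 0 ≤ θ₃' := h30.trans h3
  have hE'0 : 0 ≤ θE' := hE0.trans hE
  gcongr

/-- `QuadAnalytic` is monotone in its constant (a larger (98)-constant is still a (98)-constant). [folklore]
[cite: Balaban1985Variational, Prop. 4 (98) p.293] -/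
theorem quadAnalytic_mono_const {𝒴 𝒵 : Type*} [NormedAddCommGroup 𝒴] [NormedSpace ℂ 𝒴] [NormedAddCommGroup 𝒵] [NormedSpace ℂ 𝒵]
    {W : 𝒴 → 𝒵} {C₄ C₄' R : ℝ} (h : QuadAnalytic W C₄ R) (hle : C₄ ≤ C₄') : QuadAnalytic W C₄' R :=
  ⟨fun Y hY => (h.quad Y hY).trans (mul_le_mul_of_nonneg_right hle (sq_nonneg _)), h.lineAnalytic⟩

/-! ## §4 The (98)-slot of `W80` with `R′`, `C₄` chosen BEFORE the data -/

section Uniform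

/-- **THE W-SLOT CLAUSES OF THE ONE-INSTANCE CHART WITH `(R′, C₄)` UNIFORM IN THE DATA** — leaf-01's `exists_quadAnalytic_W80` with the
quantifiers COMMUTED: for numbers `b, C₂ ≥ 0`, `ε_C ≥ 0`, `a_C > 0` with `2(ε_C + a_C) ≤ c₄`, `4bC₂(ε_C + a_C) < 1`, the V₀-slot letters `C_V ≥ 0`,
`R_V > 0`, and bounds `M_ρ, M_τ, M_J, M_Δ, M_D ≥ 0`, there are `R′ ∈ (0, a_C]` and `C₄ ≥ 0` such that for EVERY `∇` with `‖∇g‖ ≤ M_D‖g‖`, EVERY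
`H`, `C` in `Regime H 0 C b 0 C₂ c₄ 0 a_C ε_C` with `Prop4Hyp C C₂ c₄`, EVERY `ρ`, `tr`, `U₀` with `‖ρ‖ ≤ M_ρ`, `‖tr‖ ≤ M_τ` and the V₀-group's slot
`‖curV0 Y‖ ≤ C_V‖Y‖²` on `‖Y‖ < R_V`, and EVERY `J`, `Δ_π` with `‖J‖ ≤ M_J`, `‖Δ_π‖ ≤ M_Δ`:
`QuadAnalytic (W80 ρ tr U₀ H C ε_C J Δ_π) C₄ R′ ∧ AnalyticOnNhd ℂ (W80 …) {‖Y‖ < R′}`.  Letters: `ℓ = 1∕(1 − 4bC₂(ε_C + a_C))`,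
`R₃ = min a_C (c₄∕(2(ℓ+1)))`, `γ = b(4C₂(ℓ+1)·bC₂ℓ² + 16C₂∕c₄)` (`B11Eq56CubicRemainderUniform`), `R′ = min (R₃∕2) ((1 − 4bC₂(ε_C + a_C))R_V)`,
`θ_E = κ̄(M_D)·bC₂ℓ²a_C²∕(R′(a_C − R′))`, `θ₃ = κ̄(M_D)·γR₃³∕(R′²(R₃ − R′))`, `C₄ = C4W M_ρ M_τ M_J M_Δ b C₂ ℓ θ₃ θ_E C_V R′`.
Uniform in the DATA at a fixed lattice only (`κ̄` is a double bond sum); NOT (97)'s «d and L only».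
[cite: Balaban1985Variational, Prop. 4 (97)–(98) pp.292–293, (73) p.289] -/
theorem exists_quadAnalytic_W80_uniform [CompleteSpace 𝒳] [CompleteSpace 𝔸] {b C₂ c₄ aC εC CV RV Mρ Mτ MJ MΔ MD : ℝ}
    (hb : 0 ≤ b) (hC₂ : 0 ≤ C₂) (haC : 0 < aC) (hεC : 0 ≤ εC) (hdom : 2 * (εC + aC) ≤ c₄) (hcontr : 4 * b * C₂ * (εC + aC) < 1)
    (hCV : 0 ≤ CV) (hRV : 0 < RV) (hMρ : 0 ≤ Mρ) (hMτ : 0 ≤ Mτ) (hMJ : 0 ≤ MJ) (hMΔ : 0 ≤ MΔ) (hMD : 0 ≤ MD) :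
    ∃ R' : ℝ, 0 < R' ∧ R' ≤ aC ∧ ∃ C₄ : ℝ, 0 ≤ C₄ ∧
      ∀ {Dc : (Bond d Pd → 𝔸) →ₗ[ℂ] (κ' → 𝔸)}, (∀ g : Bond d Pd → 𝔸, ‖Dc g‖ ≤ MD * ‖g‖) →
      ∀ {H : 𝒳 →L[ℂ] Space115 L η lev₀ lev₁ Dc} {C : Space115 L η lev₀ lev₁ Dc → 𝒳},
        Regime H 0 C b 0 C₂ c₄ 0 aC εC → Prop4Hyp C C₂ c₄ →
      ∀ (ρ : (𝔸 →L[ℂ] ℂ) →L[ℂ] 𝔸) (τ : 𝔸 →L[ℂ] ℂ) (U₀ : Bond d Pd → 𝔸ˣ), ‖ρ‖ ≤ Mρ → ‖τ‖ ≤ Mτ →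
        (∀ Y : Space115 L η lev₀ lev₁ Dc, ‖Y‖ < RV → ‖curV0 (lev₁ := lev₁) (Dc := Dc) ρ τ U₀ Y‖ ≤ CV * ‖Y‖ ^ 2) →
      ∀ (J : NegSize L η lev₀ 3 𝔸) (Δπ : Space115 L η lev₀ lev₁ Dc →L[ℂ] NegSize L η lev₀ 3 𝔸), ‖J‖ ≤ MJ → ‖Δπ‖ ≤ MΔ →
        QuadAnalytic (W80 ρ τ U₀ H C εC J Δπ) C₄ R' ∧
          AnalyticOnNhd ℂ (W80 ρ τ U₀ H C εC J Δπ) {Y : Space115 L η lev₀ lev₁ Dc | ‖Y‖ < R'} := by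
  -- the closed-form letters
  have hq : 0 < 1 - 4 * b * C₂ * (εC + aC) := by linarith
  have hc₄ : 0 < c₄ := by linarith
  set ℓ : ℝ := 1 / (1 - 4 * b * C₂ * (εC + aC)) with hℓ
  have hℓ0 : 0 < ℓ := by rw [hℓ]; positivity
  set R₃ : ℝ := min aC (c₄ / (2 * (ℓ + 1))) with hR₃
  have hR₃0 : 0 < R₃ := lt_min haC (by positivity)
  have hR₃a : R₃ ≤ aC := min_le_left _ _
  set γ : ℝ := b * (4 * C₂ * (ℓ + 1) * (b * C₂ * ℓ ^ 2) + 16 * C₂ / c₄) with hγ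
  have hγ0 : 0 ≤ γ := by rw [hγ]; positivity
  set R' : ℝ := min (R₃ / 2) ((1 - 4 * b * C₂ * (εC + aC)) * RV) with hR'
  have hR'0 : 0 < R' := lt_min (by positivity) (mul_pos hq hRV)
  have hR'R : R' < R₃ := lt_of_le_of_lt (min_le_left _ _) (by linarith)
  have hR'a : R' < aC := lt_of_lt_of_le hR'R hR₃a
  have hR'V : R' ≤ (1 - 4 * b * C₂ * (εC + aC)) * RV := min_le_right _ _
  set κb : ℝ := ∑ bb : Bond d Pd, ∑ b' : Bond d Pd, levWeight L η lev₀ 3 bb / levWeight L η lev₀ 3 b'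
      * (levWeight L η lev₀ 1 b')⁻¹ * max (levWeight L η lev₀ 1 bb) ((NegSup.wSup (levWeight L η lev₁ 2) : ℝ) * MD) with hκb
  have hw : ∀ b : Bond d Pd, 0 < levWeight L η lev₀ 3 b := levWeight_pos (Fact.out : 0 < L) (Fact.out : 0 < η) lev₀ 3
  have hw1 : ∀ b : Bond d Pd, 0 < levWeight L η lev₀ 1 b := levWeight_pos (Fact.out : 0 < L) (Fact.out : 0 < η) lev₀ 1
  have hκb0 : 0 ≤ κb := Finset.sum_nonneg fun bb _ => Finset.sum_nonneg fun b' _ => by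
    have := (hw bb).le; have := (hw b').le; have := (hw1 b').le; have := (hw1 bb).le
    have : 0 ≤ max (levWeight L η lev₀ 1 bb) ((NegSup.wSup (levWeight L η lev₁ 2) : ℝ) * MD) := le_max_of_le_left (hw1 bb).le
    positivity
  set θE : ℝ := κb * (b * C₂ * (1 / (1 - 4 * b * C₂ * (εC + aC))) ^ 2 * aC ^ 2 / (R' * (aC - R'))) with hθE
  have haR : 0 < aC - R' := sub_pos.2 hR'a
  have hθE0 : 0 ≤ θE := by rw [hθE]; positivity
  set θ₃ : ℝ := κb * (γ * R₃ ^ 3 / (R' ^ 2 * (R₃ - R'))) with hθ₃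
  have hRR : 0 < R₃ - R' := sub_pos.2 hR'R
  have hθ₃0 : 0 ≤ θ₃ := by rw [hθ₃]; positivity
  refine ⟨R', hR'0, hR'a.le, C4W Mρ Mτ MJ MΔ b C₂ ℓ θ₃ θE CV R',
    C4W_nonneg hMρ hMτ hMJ hMΔ hb hC₂ hθ₃0 hθE0 hCV hR'0.le, ?_⟩
  intro Dc hD H C RC hC ρ τ U₀ hρ hτ hqV J Δπ hJ hΔ
  -- the per-datum column constant is at most `κ̄`
  have hκ := colConst_le (L := L) (η := η) (lev₀ := lev₀) (lev₁ := lev₁) (Dc := Dc) hMD hD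
  -- the two kernel binders at the uniform letters
  have hΘE : ∀ A' : Space115 L η lev₀ lev₁ Dc, ‖A'‖ < R' → ∀ bb : Bond d Pd, ∑ b' : Bond d Pd,
      levWeight L η lev₀ 3 bb / levWeight L η lev₀ 3 b' * ‖kernel (fderiv ℂ (Emap H C εC) A') b' bb‖ ≤ θE * ‖A'‖ := by
    intro A' hA' bb
    refine (colSum_kernel_fderiv_Emap_le RC hC hR'0 hR'a hA' bb).trans ?_
    rw [hθE]
    have hX : 0 ≤ b * C₂ * (1 / (1 - 4 * b * C₂ * (εC + aC))) ^ 2 * aC ^ 2 / (R' * (aC - R')) := by positivity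
    have := mul_le_mul_of_nonneg_right hκ hX
    exact mul_le_mul_of_nonneg_right this (norm_nonneg A')
  have hcub : ∀ Y : Space115 L η lev₀ lev₁ Dc, ‖Y‖ < R₃ → ‖E3 H C εC Y‖ ≤ γ * ‖Y‖ ^ 3 := fun Y hY =>
    norm_E3_le_cubic RC hC hY
  have hΘ3 : ∀ A' : Space115 L η lev₀ lev₁ Dc, ‖A'‖ < R' → ∀ bb : Bond d Pd, ∑ b' : Bond d Pd,
      levWeight L η lev₀ 3 bb / levWeight L η lev₀ 3 b' * ‖kernel (fderiv ℂ (E3 H C εC) A') b' bb‖ ≤ θ₃ * ‖A'‖ ^ 2 := by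
    intro A' hA' bb
    refine (colSum_kernel_fderiv_E3_le_of_cubic RC hC hR₃a hγ0 hcub hR'0 hR'R hA' bb).trans ?_
    rw [hθ₃]
    have hX : 0 ≤ γ * R₃ ^ 3 / (R' ^ 2 * (R₃ - R')) := by positivity
    have := mul_le_mul_of_nonneg_right hκ hX
    exact mul_le_mul_of_nonneg_right this (sq_nonneg _)
  -- (E)'s slot at the uniform letters, then monotonicity in the remaining norms
  have hW := quadAnalytic_W80 ρ τ U₀ hCV hqV RC hC J Δπ hθ₃0 hθE0 hR'0.le hR'a.le hR'V hΘE hΘ3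
  refine ⟨quadAnalytic_mono_const hW.1 ?_, hW.2⟩
  exact C4W_mono (norm_nonneg ρ) (norm_nonneg τ) (norm_nonneg J) (norm_nonneg Δπ) hb hC₂ hθ₃0 hθE0 hCV hR'0.le hρ hτ hJ hΔ
    le_rfl le_rfl

end Uniform

end Literature.MathematicalPhysics.QuantumFieldTheory.Balaban1983to89.B11Ineq73KernelLettersUniform

end
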